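import Summits.BirchSwinnertonDyer.BirchSwinnertonDyer.Theses.LeadingTerm
import Summits.BirchSwinnertonDyer.BirchSwinnertonDyer.Theorems.LeadingTermRankLeOne
import Summits.BirchSwinnertonDyer.BirchSwinnertonDyer.Theorems.LeadingTermLBOfCruxes
import Summits.BirchSwinnertonDyer.BirchSwinnertonDyer.Theorems.PAdicOrderV2PAdicOrderComparisonR2StubTwoLeOrder
import Literature.NumberTheory.EllipticCurves.CanonicalPAdicHeightHolds
import HarnessLib

/-!
# BirchSwinnertonDyer / LeadingTerm — crux `Consistency` (stmt-BirchSwinnertonDyer-16217),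
# line `Sketch`: the cell decomposition (exact partition of the crux)

Crux #2 `Consistency` of route `LeadingTerm`: for every elliptic `E/ℚ` (globally minimal `W`),
every good ordinary `p ≥ 5`, canonical cyclotomic height datum `D` and newform `f` of `E`, with
`r := rank_ℤ E(ℚ)`: `Reg_∞ > 0 ∧ Ω⁺_f > 0 ∧ ∃ q : ℚ, L^{(r)}(E,1) = r!·q·Ω⁺_f·Reg_∞ ∧
[T^r]L_p(f,α)·log_p(γ)^r = q·(1-α⁻¹)²·Reg_p(D)`.

This file is the KERNEL-CHECKED BOOKKEEPING of line `Sketch` (skeleton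
`Cruxes/Consistency/Lines/Sketch.lean`): the crux is cut along the cells `(r_MW, r_an)`, every
cell that is a theorem of the tree is discharged, and the crux is shown EQUIVALENT — modulo the
route's items `SqueezeUBR2` (crux #4, no excess rank), `RankLeOne` (the known diagonal slice
`r ≤ 1`) and `PAdicOrderKatoSideR2` (crux #5, Kato's rank bound) — to the conjunction of the
line's registered open stubs:

* `r_MW = 0` (all cells, any `D`): `leadingTerm_consistency_of_rank_zero` (Mazur–Swinnerton-Dyer
  interpolation, `q = [0]⁺_f`; landed in `LeadingTermRankLeOne`).
* excess cells `r_MW > r_an`: empty by `SqueezeUBR2`.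
* diagonal `r_MW = r_an = 1`: `RankLeOne`; `r_MW = r_an ≥ 2`: stub **S2** (the rank-`≥ 2`
  `p`-adic Beilinson formula, Burns–Kurihara–Sano arXiv:1910.07404 Cor. 1.10 — open beyond `r = 1`).
* deficient cells `r_MW < r_an`: the archimedean identity forces `q = 0`
  (`iteratedDeriv_entireLFunction_eq_zero_of_lt_analyticRank`), so the crux there is ONE vanishing
  coefficient `[T^{r_MW}]L_p = 0` (`consistencyAt_of_coeff_eq_zero`): `(1, even)` is a theorem
  (`coeff_one_padicLFunction_eq_zero_of_even`: `ord_T L_p ≥ 1` and `≡ r_an (mod 2)` from the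
  landed hypothesis-free PAdicOrderV2 stubs); `(≥ 2, mismatched parity)` follows from
  `PAdicOrderKatoSideR2` (`coeff_padicLFunction_eq_zero_of_katoSide_of_mismatch`); `(1, odd ≥ 3)`
  is stub **S1a** (known in print: Perrin-Riou 1987 torsion transfer; closure
  `stub_deficient_one_odd_of_facts` landed) and `(≥ 2, matched parity)` is stub **S1b** (open from
  the cell `(2,4)`: `p`-adic order domination at `r_an ≥ 4`; closures modulo the sibling crux
  `PAdicOrderComparisonR2` / the Selmer side + Kato landed).

`consistency_of_open_stubs` and `open_stubs_of_consistency` together say: GIVEN the three items,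
`Consistency ↔ S1a ∧ S1b ∧ S2`, and unconditionally `Consistency → S1a ∧ S1m ∧ S1b ∧ S2` — no
registered stub is stronger than the crux.
-/

set_option linter.dupNamespace false

namespace Summit.BirchSwinnertonDyer.BirchSwinnertonDyer.Theorems

open scoped MatrixGroups ModularForm
open CongruenceSubgroup Literature.NumberTheory.EllipticCurves
  Literature.NumberTheory.EllipticCurves.ModularForms WeierstrassCurve
open Summit.BirchSwinnertonDyer.BirchSwinnertonDyer.Theses.LeadingTerm (Consistency RankLeOne
  SqueezeUBR2 PAdicOrderKatoSideR2)

/-! ### Proved cells -/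

/-- Below the analytic rank the Taylor coefficients of `L(E,s)` at `s = 1` vanish (junk-robust:
`analyticRank = 0` when `L` is not analytic at `1` or vanishes identically near `1`). [folklore] -/
theorem iteratedDeriv_entireLFunction_eq_zero_of_lt_analyticRank (W : WeierstrassCurve ℚ) {n : ℕ}
    (hn : n < W.analyticRank) : iteratedDeriv n W.entireLFunction 1 = 0 := by
  have han : AnalyticAt ℂ W.entireLFunction 1 := by
    by_contra h
    have : W.analyticRank = 0 := by
      unfold WeierstrassCurve.analyticRank
      exact analyticOrderNatAt_of_not_analyticAt h
    omega
  have htop : analyticOrderAt W.entireLFunction 1 ≠ ⊤ := by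
    intro h
    have : W.analyticRank = 0 := by
      unfold WeierstrassCurve.analyticRank analyticOrderNatAt
      rw [h]; rfl
    omega
  have hcast : ((W.analyticRank : ℕ) : ℕ∞) = analyticOrderAt W.entireLFunction 1 := by
    unfold WeierstrassCurve.analyticRank
    exact Nat.cast_analyticOrderNatAt htop
  exact (natCast_le_analyticOrderAt_iff_iteratedDeriv_eq_zero han).mp hcast.le n hn

/-- **Deficient cells**: if `r_MW < r_an` and `[T^{r_MW}]L_p(E,T) = 0` then the crux holds at
`(W, p, D, f)` with `q = 0` (both sides of both identities vanish; `Reg_∞ > 0`, `Ω⁺_f > 0` by the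
tree theorems `regulator_pos_holds`, `IsNewform0.plusPeriod_pos_holds`). [folklore] -/
theorem consistencyAt_of_coeff_eq_zero (W : WeierstrassCurve ℚ) [W.IsElliptic]
    [W.IsGloballyMinimal] (p : ℕ) [Fact p.Prime] (D : PAdicHeightData W p) {N : ℕ} [NeZero N]
    (f : CuspForm (Gamma0 N) 2) (hf : IsNewformOf W f) (hlt : W.mordellWeilRank < W.analyticRank)
    (hcoeff : PowerSeries.coeff W.mordellWeilRank (padicLFunction f (unitRoot W p : ℚ_[p])) = 0) :
    0 < W.regulator ∧ 0 < plusPeriod f ∧ ∃ q : ℚ,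
      iteratedDeriv W.mordellWeilRank W.entireLFunction 1 =
        (((W.mordellWeilRank.factorial : ℝ) * (q : ℝ) * plusPeriod f * W.regulator : ℝ) : ℂ) ∧
      PowerSeries.coeff W.mordellWeilRank (padicLFunction f (unitRoot W p : ℚ_[p])) *
          padicLog p (cyclotomicGenerator p) ^ W.mordellWeilRank =
        (q : ℚ_[p]) * (1 - (unitRoot W p : ℚ_[p])⁻¹) ^ 2 * padicRegulator D := by
  refine ⟨regulator_pos_holds W, IsNewform0.plusPeriod_pos_holds hf.1 hf.coeffField_eq_bot, 0,
    ?_, ?_⟩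
  · rw [iteratedDeriv_entireLFunction_eq_zero_of_lt_analyticRank W hlt]
    push_cast
    ring
  · rw [hcoeff]
    push_cast
    ring

/-- **Cell `(1, even)`** and more generally: if `r_an ≥ 2` is EVEN then `[T¹]L_p(E,T) = 0`, since
`ord_T L_p ≥ 1` (`stub_constantCoeff_eq_zero_iff`: `L_p(E,0) = (1-α⁻¹)²·L(E,1)/Ω⁺ = 0`) and
`ord_T L_p ≡ r_an (mod 2)` (`stub_even_order_iff_even_analyticRank`, same sign in both functional
equations), so `ord_T L_p ≥ 2`. [cite: GreenbergLNM1716, §5 (p. 181)] -/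
theorem coeff_one_padicLFunction_eq_zero_of_even (W : WeierstrassCurve ℚ) [W.IsElliptic]
    [W.IsGloballyMinimal] (p : ℕ) [Fact p.Prime] (hord : IsOrdinaryAt W p) {N : ℕ} [NeZero N]
    (f : CuspForm (Gamma0 N) 2) (hf : IsNewformOf W f) (h2 : 2 ≤ W.analyticRank)
    (hev : Even W.analyticRank) :
    PowerSeries.coeff 1 (padicLFunction f (unitRoot W p : ℚ_[p])) = 0 := by
  set L := padicLFunction f (unitRoot W p : ℚ_[p]) with hL
  have hc : PowerSeries.constantCoeff L = 0 :=
    (stub_constantCoeff_eq_zero_iff W p hord f hf).mpr (by omega)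
  have hpar := stub_even_order_iff_even_analyticRank W p hord f hf
  by_cases htop : L.order = ⊤
  · have h0 : L = 0 := PowerSeries.order_eq_top.mp htop
    rw [h0, map_zero]
  · obtain ⟨n, hn⟩ := ENat.ne_top_iff_exists.mp htop
    have h1le : ((1 : ℕ) : ℕ∞) ≤ L.order := by
      refine PowerSeries.nat_le_order _ 1 fun i hi => ?_
      have hi0 : i = 0 := by omega
      subst hi0
      simpa only [PowerSeries.coeff_zero_eq_constantCoeff] using hc
    rw [← hL, ← hn] at hpar
    rw [← hn] at h1le
    have hn1 : 1 ≤ n := by exact_mod_cast h1le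
    have hne : Even n := by simpa using hpar.mpr hev
    have h2n : 2 ≤ n := by obtain ⟨k, hk⟩ := hne; omega
    apply PowerSeries.coeff_of_lt_order
    rw [← hn]
    exact_mod_cast (by omega : 1 < n)

/-- **Cells `(≥ 2, mismatched parity)` from the route item `PAdicOrderKatoSideR2`** (Kato's rank
bound `rank E(ℚ) ≤ ord_T L_p(E,T)`, Astérisque 295 Thm 18.4, as crux #5 of route `LeadingTerm`,
stmt-BirchSwinnertonDyer-0491): `r_MW ≤ ord_T L_p` (the item at `p ≠ 2`),
`ord_T L_p ≡ r_an (mod 2)` (`stub_even_order_iff_even_analyticRank`) and `r_MW ≢ r_an (mod 2)`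
give `r_MW < ord_T L_p`, so `[T^{r_MW}]L_p = 0`. (Same statement as the registered closure
`stub_deficient_two_le_mismatch_of_katoSide`; repeated here to keep this file's import cone to
the four modules above.) [cite: Kato2004Asterisque, Thm 18.4 (p. 281)] -/
theorem coeff_padicLFunction_eq_zero_of_katoSide_of_mismatch (hK : PAdicOrderKatoSideR2)
    (W : WeierstrassCurve ℚ) [W.IsElliptic] [W.IsGloballyMinimal] (p : ℕ) [Fact p.Prime]
    (h5 : 5 ≤ p) (hord : IsOrdinaryAt W p) {N : ℕ} [NeZero N] (f : CuspForm (Gamma0 N) 2)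
    (hf : IsNewformOf W f) (hpar : (Even W.mordellWeilRank ↔ Odd W.analyticRank)) :
    PowerSeries.coeff W.mordellWeilRank (padicLFunction f (unitRoot W p : ℚ_[p])) = 0 := by
  have hle : (W.mordellWeilRank : ℕ∞) ≤ (padicLFunction f (unitRoot W p : ℚ_[p])).order :=
    hK W p (by omega) hord f hf
  have hparity := stub_even_order_iff_even_analyticRank W p hord f hf
  by_cases htop : (padicLFunction f (unitRoot W p : ℚ_[p])).order = ⊤
  · rw [PowerSeries.order_eq_top.mp htop, map_zero]
  · obtain ⟨n, hn⟩ := ENat.ne_top_iff_exists.mp htop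
    rw [← hn] at hle hparity
    rw [ENat.toNat_coe] at hparity
    have hle' : W.mordellWeilRank ≤ n := by exact_mod_cast hle
    have hne : W.mordellWeilRank ≠ n := by
      rintro rfl
      simp only [Nat.even_iff, Nat.odd_iff] at hpar hparity
      omega
    refine PowerSeries.coeff_of_lt_order _ ?_
    rw [← hn]
    exact_mod_cast lt_of_le_of_ne hle' hne

/-! ### Composition and exactness -/

/-- **Composition of line `Sketch`.** From the route's items `SqueezeUBR2` (crux #4),
`RankLeOne` (known diagonal slice `r ≤ 1`), `PAdicOrderKatoSideR2` (crux #5, Kato's rank bound)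
and the three open stubs S1a (deficient cell `(1, odd ≥ 3)`), S1b (deficient cells `2 ≤ r_MW`,
matched parity) and S2 (diagonal `r ≥ 2`), the crux `Consistency` follows BY NAME:
`r_MW = 0` by `leadingTerm_consistency_of_rank_zero`; excess cells are empty by `SqueezeUBR2`;
diagonal `r = 1` by `RankLeOne`, `r ≥ 2` by S2; deficient cells by `q = 0` and one vanishing
coefficient — `(1, even)` proved, `(≥ 2, mismatched)` from Kato's bound, `(1, odd ≥ 3)` S1a,
`(≥ 2, matched)` S1b. [folklore] -/
theorem consistency_of_open_stubs :
    Summit.BirchSwinnertonDyer.BirchSwinnertonDyer.Theses.LeadingTerm.SqueezeUBR2 →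
      Summit.BirchSwinnertonDyer.BirchSwinnertonDyer.Theses.LeadingTerm.RankLeOne →
      Summit.BirchSwinnertonDyer.BirchSwinnertonDyer.Theses.LeadingTerm.PAdicOrderKatoSideR2 → (∀ (W
      : WeierstrassCurve ℚ) [W.IsElliptic] [W.IsGloballyMinimal] (p : ℕ) [Fact p.Prime], 5 ≤ p →
      Literature.NumberTheory.EllipticCurves.IsOrdinaryAt W p → ∀ {N : ℕ} [NeZero N] (f : CuspForm
      (CongruenceSubgroup.Gamma0 N) 2),
      Literature.NumberTheory.EllipticCurves.ModularForms.IsNewformOf W f → W.mordellWeilRank = 1 →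
      Odd W.analyticRank → 3 ≤ W.analyticRank → PowerSeries.coeff 1
      (Literature.NumberTheory.EllipticCurves.padicLFunction f
      (Literature.NumberTheory.EllipticCurves.unitRoot W p : ℚ_[p])) = 0) → (∀ (W : WeierstrassCurve
      ℚ) [W.IsElliptic] [W.IsGloballyMinimal] (p : ℕ) [Fact p.Prime], 5 ≤ p →
      Literature.NumberTheory.EllipticCurves.IsOrdinaryAt W p → ∀ {N : ℕ} [NeZero N] (f : CuspForm
      (CongruenceSubgroup.Gamma0 N) 2),
      Literature.NumberTheory.EllipticCurves.ModularForms.IsNewformOf W f → 2 ≤ W.mordellWeilRank →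
      W.mordellWeilRank < W.analyticRank → (Even W.mordellWeilRank ↔ Even W.analyticRank) →
      PowerSeries.coeff W.mordellWeilRank (Literature.NumberTheory.EllipticCurves.padicLFunction f
      (Literature.NumberTheory.EllipticCurves.unitRoot W p : ℚ_[p])) = 0) → (∀ (W : WeierstrassCurve
      ℚ) [W.IsElliptic] [W.IsGloballyMinimal] (p : ℕ) [Fact p.Prime], 5 ≤ p →
      Literature.NumberTheory.EllipticCurves.IsOrdinaryAt W p → ∀ (D :
      WeierstrassCurve.PAdicHeightData W p), D.IsCanonical → ∀ ⦃N : ℕ⦄ [NeZero N] (f : CuspForm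
      (CongruenceSubgroup.Gamma0 N) 2),
      Literature.NumberTheory.EllipticCurves.ModularForms.IsNewformOf W f → 2 ≤ W.mordellWeilRank →
      W.analyticRank = W.mordellWeilRank → 0 < W.regulator ∧ 0 <
      Literature.NumberTheory.EllipticCurves.ModularForms.plusPeriod f ∧ ∃ q : ℚ, iteratedDeriv
      W.mordellWeilRank W.entireLFunction 1 = (((W.mordellWeilRank.factorial : ℝ) * (q : ℝ) *
      Literature.NumberTheory.EllipticCurves.ModularForms.plusPeriod f * W.regulator : ℝ) : ℂ) ∧
      PowerSeries.coeff W.mordellWeilRank (Literature.NumberTheory.EllipticCurves.padicLFunction f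
      (Literature.NumberTheory.EllipticCurves.unitRoot W p : ℚ_[p])) *
      Literature.NumberTheory.EllipticCurves.padicLog p
      (Literature.NumberTheory.EllipticCurves.cyclotomicGenerator p) ^ W.mordellWeilRank = (q :
      ℚ_[p]) * (1 - (Literature.NumberTheory.EllipticCurves.unitRoot W p : ℚ_[p])⁻¹) ^ 2 *
      WeierstrassCurve.padicRegulator D) →
      Summit.BirchSwinnertonDyer.BirchSwinnertonDyer.Theses.LeadingTerm.Consistency := by
  intro hUB hR1 hK hS1a hS1b hS2 W _ _ p _ h5 hord D hD N _ f hf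
  rcases Nat.eq_zero_or_pos W.mordellWeilRank with h0 | hpos
  · exact leadingTerm_consistency_of_rank_zero W p hord h0 D f hf
  have hub : W.mordellWeilRank ≤ W.analyticRank := hUB W
  rcases hub.eq_or_lt with heq | hlt
  · -- diagonal
    by_cases h1 : W.mordellWeilRank = 1
    · exact hR1 W p h5 hord h1.le heq.symm D hD f hf
    · exact hS2 W p h5 hord D hD f hf (by omega) heq.symm
  · -- deficient: one vanishing coefficient, `q = 0`
    refine consistencyAt_of_coeff_eq_zero W p D f hf hlt ?_
    by_cases h1 : W.mordellWeilRank = 1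
    · rw [h1]
      rcases Nat.even_or_odd W.analyticRank with hev | hodd
      · exact coeff_one_padicLFunction_eq_zero_of_even W p hord f hf (by omega) hev
      · have h3 : 3 ≤ W.analyticRank := by
          obtain ⟨k, hk⟩ := hodd
          omega
        exact hS1a W p h5 hord f hf h1 hodd h3
    · by_cases hpar : (Even W.mordellWeilRank ↔ Even W.analyticRank)
      · exact hS1b W p h5 hord f hf (by omega) hlt hpar
      · have hpar' : (Even W.mordellWeilRank ↔ Odd W.analyticRank) := by
          rw [← Nat.not_even_iff_odd]; tauto
        exact coeff_padicLFunction_eq_zero_of_katoSide_of_mismatch hK W p h5 hord f hf hpar'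

/-- **No stub is stronger than the crux**: `Consistency → S1a ∧ S1m ∧ S1b ∧ S2`. S2 is a restriction; in
a deficient cell the archimedean identity reads `0 = r!·q·Ω⁺·Reg_∞` (the `r_MW`-th Taylor
coefficient vanishes below the analytic order), so `q = 0` (`Ω⁺_f, Reg_∞ > 0`), and the `p`-adic
identity gives `[T^{r_MW}]L_p · log_p(γ)^{r_MW} = 0` with `log_p γ ≠ 0`
(`leadingTerm_padicLog_cyclotomicGenerator_ne_zero`); a canonical `D` to instantiate the crux exists
at every good ordinary `p ≥ 5` (`exists_isCanonical_holds`). [folklore] -/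
theorem open_stubs_of_consistency :
    Summit.BirchSwinnertonDyer.BirchSwinnertonDyer.Theses.LeadingTerm.Consistency → (∀ (W :
      WeierstrassCurve ℚ) [W.IsElliptic] [W.IsGloballyMinimal] (p : ℕ) [Fact p.Prime], 5 ≤ p →
      Literature.NumberTheory.EllipticCurves.IsOrdinaryAt W p → ∀ {N : ℕ} [NeZero N] (f : CuspForm
      (CongruenceSubgroup.Gamma0 N) 2),
      Literature.NumberTheory.EllipticCurves.ModularForms.IsNewformOf W f → W.mordellWeilRank = 1 →
      Odd W.analyticRank → 3 ≤ W.analyticRank → PowerSeries.coeff 1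
      (Literature.NumberTheory.EllipticCurves.padicLFunction f
      (Literature.NumberTheory.EllipticCurves.unitRoot W p : ℚ_[p])) = 0) ∧ (∀ (W : WeierstrassCurve
      ℚ) [W.IsElliptic] [W.IsGloballyMinimal] (p : ℕ) [Fact p.Prime], 5 ≤ p →
      Literature.NumberTheory.EllipticCurves.IsOrdinaryAt W p → ∀ {N : ℕ} [NeZero N] (f : CuspForm
      (CongruenceSubgroup.Gamma0 N) 2),
      Literature.NumberTheory.EllipticCurves.ModularForms.IsNewformOf W f → 2 ≤ W.mordellWeilRank →
      W.mordellWeilRank < W.analyticRank → (Even W.mordellWeilRank ↔ Odd W.analyticRank) →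
      PowerSeries.coeff W.mordellWeilRank (Literature.NumberTheory.EllipticCurves.padicLFunction f
      (Literature.NumberTheory.EllipticCurves.unitRoot W p : ℚ_[p])) = 0) ∧ (∀ (W : WeierstrassCurve
      ℚ) [W.IsElliptic] [W.IsGloballyMinimal] (p : ℕ) [Fact p.Prime], 5 ≤ p →
      Literature.NumberTheory.EllipticCurves.IsOrdinaryAt W p → ∀ {N : ℕ} [NeZero N] (f : CuspForm
      (CongruenceSubgroup.Gamma0 N) 2),
      Literature.NumberTheory.EllipticCurves.ModularForms.IsNewformOf W f → 2 ≤ W.mordellWeilRank →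
      W.mordellWeilRank < W.analyticRank → (Even W.mordellWeilRank ↔ Even W.analyticRank) →
      PowerSeries.coeff W.mordellWeilRank (Literature.NumberTheory.EllipticCurves.padicLFunction f
      (Literature.NumberTheory.EllipticCurves.unitRoot W p : ℚ_[p])) = 0) ∧ (∀ (W : WeierstrassCurve
      ℚ) [W.IsElliptic] [W.IsGloballyMinimal] (p : ℕ) [Fact p.Prime], 5 ≤ p →
      Literature.NumberTheory.EllipticCurves.IsOrdinaryAt W p → ∀ (D :
      WeierstrassCurve.PAdicHeightData W p), D.IsCanonical → ∀ ⦃N : ℕ⦄ [NeZero N] (f : CuspForm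
      (CongruenceSubgroup.Gamma0 N) 2),
      Literature.NumberTheory.EllipticCurves.ModularForms.IsNewformOf W f → 2 ≤ W.mordellWeilRank →
      W.analyticRank = W.mordellWeilRank → 0 < W.regulator ∧ 0 <
      Literature.NumberTheory.EllipticCurves.ModularForms.plusPeriod f ∧ ∃ q : ℚ, iteratedDeriv
      W.mordellWeilRank W.entireLFunction 1 = (((W.mordellWeilRank.factorial : ℝ) * (q : ℝ) *
      Literature.NumberTheory.EllipticCurves.ModularForms.plusPeriod f * W.regulator : ℝ) : ℂ) ∧
      PowerSeries.coeff W.mordellWeilRank (Literature.NumberTheory.EllipticCurves.padicLFunction f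
      (Literature.NumberTheory.EllipticCurves.unitRoot W p : ℚ_[p])) *
      Literature.NumberTheory.EllipticCurves.padicLog p
      (Literature.NumberTheory.EllipticCurves.cyclotomicGenerator p) ^ W.mordellWeilRank = (q :
      ℚ_[p]) * (1 - (Literature.NumberTheory.EllipticCurves.unitRoot W p : ℚ_[p])⁻¹) ^ 2 *
      WeierstrassCurve.padicRegulator D) := by
  intro hC
  -- the deficient-cell extraction, for any rank
  have key : ∀ (W : WeierstrassCurve ℚ) [W.IsElliptic] [W.IsGloballyMinimal] (p : ℕ) [Fact p.Prime],
      5 ≤ p → IsOrdinaryAt W p →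
      ∀ {N : ℕ} [NeZero N] (f : CuspForm (Gamma0 N) 2), IsNewformOf W f →
        W.mordellWeilRank < W.analyticRank →
          PowerSeries.coeff W.mordellWeilRank (padicLFunction f (unitRoot W p : ℚ_[p])) = 0 := by
    intro W _ _ p _ h5 hord N _ f hf hlt
    obtain ⟨D, hD⟩ := exists_isCanonical_holds W p h5 hord.1 hord.2
    obtain ⟨hreg, hΩ, q, hA, hP⟩ := hC W p h5 hord D hD f hf
    rw [iteratedDeriv_entireLFunction_eq_zero_of_lt_analyticRank W hlt] at hA
    have hq : q = 0 := by
      have hfac : (0 : ℝ) < W.mordellWeilRank.factorial := by exact_mod_cast Nat.factorial_pos _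
      have h0 : ((W.mordellWeilRank.factorial : ℝ) * (q : ℝ) * plusPeriod f * W.regulator : ℝ) = 0 := by
        exact_mod_cast hA.symm
      have : (q : ℝ) = 0 := by
        rcases mul_eq_zero.mp h0 with h | h
        · rcases mul_eq_zero.mp h with h' | h'
          · rcases mul_eq_zero.mp h' with h'' | h''
            · exact absurd h'' hfac.ne'
            · exact h''
          · exact absurd h' hΩ.ne'
        · exact absurd h hreg.ne'
      exact_mod_cast this
    rw [hq] at hP
    push_cast at hP
    rw [zero_mul, zero_mul] at hP
    exact (mul_eq_zero.mp hP).resolve_right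
      (pow_ne_zero _ (leadingTerm_padicLog_cyclotomicGenerator_ne_zero p))
  refine ⟨?_, ?_, ?_, ?_⟩
  · intro W _ _ p _ h5 hord N _ f hf h1 _ h3
    have := key W p h5 hord f hf (by omega)
    rwa [h1] at this
  · intro W _ _ p _ h5 hord N _ f hf _ hlt _
    exact key W p h5 hord f hf hlt
  · intro W _ _ p _ h5 hord N _ f hf _ hlt _
    exact key W p h5 hord f hf hlt
  · intro W _ _ p _ h5 hord D hD N _ f hf _ _
    exact hC W p h5 hord D hD f hf

end Summit.BirchSwinnertonDyer.BirchSwinnertonDyer.Theorems
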